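import Summits.ABC.IUTFork.Cor312Ind3IteratesVacuityWild
import Literature.IUT.LogVolume.UnitLogWildPrime
import HarnessLib

/-!
# [IUTchIII] Thm 3.11 (ii) (Ind3), honest model: depth `2` is INHABITED at `e = p_v` for EVERY odd prime
# (abc-iut cell, wave-5 seat abc-iut-w5-d172, gen 2; record-only, D-0012)

S. Mochizuki, *Inter-universal Teichmüller theory III*, kurims manuscript (May 2020), Prop. 3.5 (ii) (a)(b)
pp. 104–105, Rmk. 1.1.1 (i) p. 28 [claim: Mochizuki2012, status: disputed].

Generalisation of `Cor312Ind3IteratesVacuityWild` (p419392; the prime `3`) to EVERY ODD PRIME `p`, over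
abc-iut-w5-d138's `Literature.IUT.LogVolume.WildPrime.norm_unitLog_one_add_pi_eq_one` (p424842: in any complete
ultrametric normed `ℚ_p`-algebra field, `πᵖ = p`, `p` odd ⇒ `‖log_p(1+π)‖ = 1` — the term `πᵖ/p = 1` dominates).
In abc-iut-w4-d029's honest model of the log-link iterates (`Cor312Ind3RealIterates`, p412330) for the ANALYTIC
`p_v`-adic logarithms (`Real.analyticLogv`, abc-iut-c312-5):

* **`Real.nonarchIterImage_analyticLogv_two_nonempty_of_pow_prime`** — at a finite place `v` with `p ∈ 𝔭_v`, `p`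
  odd, whose completion contains `x` with `xᵖ = p`, the honest depth-`2` (Ind3) iterate image is NONEMPTY
  (`log_v(1+x) ∈ O_v^×`), and `Real.not_ramificationIdx_le_of_pow_prime`: the hypothesis `e(v|p_v) ≤ p_v − 1` of
  p414009 FAILS there (`p_v ≤ e(v|p_v)`, wild);
* the column twin `Column.unitImage_two_nonempty_of_honestImages_of_pow_prime_mem` at `v_ℚ = p`;
* **`Real.exists_numberField_nonarchIterImage_two_nonempty_of_odd_prime`** — for every odd prime `p` the instance
  EXISTS: `F = ℚ[X]/(g)`, `g` an irreducible factor of `Xᵖ − p`, and any place of `F` over `p`.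

So the tame threshold `e ≤ p_v − 1` of p414009 is SHARP AT EVERY ODD PRIME (at `p_v = 2` see
`Cor312Ind3IteratesVacuityWildDyadic`, p424522).  Honest framing: statements ABOUT THE MODEL; nothing here asserts
or denies [IUTchIII] Cor. 3.12 or takes a side; typed ≠ proved; instantiated ≠ endorsed.  No definitions, no
Prop-valued fact (D-0067 (1)).
-/

noncomputable section

open Set

namespace Summit.ABC.IUTFork.Thm311.Real

open NumberField IsDedekindDomain Literature.IUT.LogVolume Literature.IUT.LogThetaLattice
  Literature.NumberTheory.NumberFields Polynomial

variable {F : Type} [Field F] [NumberField F]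

/-! ## 1. The local computation at a general prime -/

/-- In the rescaled completion at a place over an odd prime `p`: if `xᵖ = p` then `1 + x` has norm `1` and its
`p`-adic logarithm has norm `1` (abc-iut-w5-d138's `WildPrime.norm_unitLog_one_add_pi_eq_one`).
[cite: NeukirchANT1999, Ch. II (5.5)] -/
theorem norm_rescaled_one_add_and_unitLog_eq_one_of_pow_prime (v : HeightOneSpectrum (𝓞 F)) (p : ℕ)
    [Fact p.Prime] (hv : ((p : ℕ) : 𝓞 F) ∈ v.asIdeal) (hp2 : p ≠ 2) (x : v.adicCompletion F)
    (hx : x ^ p = (p : v.adicCompletion F)) :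
    ‖RescaledCompletion.of F p v hv (1 + x)‖ = 1 ∧
      ‖unitLog (RescaledCompletion.of F p v hv (1 + x))‖ = 1 := by
  have hπ : (RescaledCompletion.of F p v hv x) ^ p = p := by
    rw [← map_pow, hx, map_natCast]
  rw [map_add, map_one]
  exact ⟨WildPrime.norm_one_add_pi hπ, WildPrime.norm_unitLog_one_add_pi_eq_one hp2 hπ⟩

/-- **The analytic logarithm of the unit `1 + x`, `xᵖ = p` (`p` odd), is a unit of `O_v`** (rescaled norm `1`),
at a finite place `v` over `p`. [cite: NeukirchANT1999, Ch. II (5.5)] -/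
theorem norm_of_analyticLogv_eq_one_of_pow_prime (v : HeightOneSpectrum (𝓞 F)) {p : ℕ} (hp : p.Prime)
    (hp2 : p ≠ 2) (hv : ((p : ℕ) : 𝓞 F) ∈ v.asIdeal) (x : v.adicCompletion F) (hx : x ^ p = (p : v.adicCompletion F))
    (w : (↥(v.adicCompletionIntegers F))ˣ)
    (hw : ((w : ↥(v.adicCompletionIntegers F)) : v.adicCompletion F) = 1 + x) :
    ‖RescaledCompletion.of F (residueChar F v) v (natCast_residueChar_mem F v)
        (analyticLogv F v (Additive.ofMul w))‖ = 1 := by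
  haveI : Fact (residueChar F v).Prime := ⟨residueChar_prime F v⟩
  have hres : residueChar F v = p := residueChar_eq_of_prime_natCast_mem v hp hv
  have hx' : x ^ (residueChar F v) = ((residueChar F v : ℕ) : v.adicCompletion F) := by rw [hres]; exact hx
  rw [analyticLogv_apply, RingEquiv.apply_symm_apply, hw]
  exact (norm_rescaled_one_add_and_unitLog_eq_one_of_pow_prime v (residueChar F v) (natCast_residueChar_mem F v)
    (hres ▸ hp2) x hx').2

/-! ## 2. Depth `2` is inhabited; the ramification hypothesis of p414009 fails -/

/-- **At a finite place `v` over an ODD prime `p` whose completion contains a `p`-th root `x` of `p`, the honest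
depth-`2` nonarchimedean (Ind3) iterate image for the ANALYTIC logarithms is NONEMPTY** (`1 + x ∈ O_v^×` has
`log_v(1 + x) ∈ O_v^×`). [claim: Mochizuki2012, status: disputed] -/
theorem nonarchIterImage_analyticLogv_two_nonempty_of_pow_prime (v : HeightOneSpectrum (𝓞 F)) {p : ℕ}
    (hp : p.Prime) (hp2 : p ≠ 2) (hv : ((p : ℕ) : 𝓞 F) ∈ v.asIdeal) (x : v.adicCompletion F)
    (hx : x ^ p = (p : v.adicCompletion F)) : (nonarchIterImage (analyticLogv F) v 2).Nonempty := by
  haveI : Fact p.Prime := ⟨hp⟩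
  have hn1 := (norm_rescaled_one_add_and_unitLog_eq_one_of_pow_prime v p hv hp2 x hx).1
  obtain ⟨w, hw⟩ := exists_unit_coe_eq_of_norm_rescaled_eq_one v p hv (1 + x) hn1
  obtain ⟨u, hu⟩ := exists_unit_coe_eq_of_norm_rescaled_eq_one v (residueChar F v)
    (natCast_residueChar_mem F v) (analyticLogv F v (Additive.ofMul w))
    (norm_of_analyticLogv_eq_one_of_pow_prime v hp hp2 hv x hx w hw)
  exact nonarchIterImage_two_nonempty_of_exists_eq_coe_unit (analyticLogv F) v ⟨w, u, hu.symm⟩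

/-- **The hypothesis `e(v|p_v) ≤ p_v − 1` of p414009 FAILS** at such a place (depth `2` is inhabited there,
while p414009 would make it empty). [claim: Mochizuki2012, status: disputed] -/
theorem not_ramificationIdx_le_of_pow_prime (v : HeightOneSpectrum (𝓞 F)) {p : ℕ} (hp : p.Prime) (hp2 : p ≠ 2)
    (hv : ((p : ℕ) : 𝓞 F) ∈ v.asIdeal) (x : v.adicCompletion F) (hx : x ^ p = (p : v.adicCompletion F)) :
    ¬ v.asIdeal.ramificationIdx ℤ ≤ residueChar F v - 1 := by
  intro he
  have h := nonarchIterImage_analyticLogv_two_nonempty_of_pow_prime v hp hp2 hv x hx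
  rw [nonarchIterImage_add_two_eq_empty v he 0] at h
  exact Set.not_nonempty_empty h

/-- Equivalently: such a place is WILDLY ramified, `p_v ≤ e(v|p_v)`. [folklore] -/
theorem residueChar_le_ramificationIdx_of_pow_prime (v : HeightOneSpectrum (𝓞 F)) {p : ℕ} (hp : p.Prime)
    (hp2 : p ≠ 2) (hv : ((p : ℕ) : 𝓞 F) ∈ v.asIdeal) (x : v.adicCompletion F)
    (hx : x ^ p = (p : v.adicCompletion F)) : residueChar F v ≤ v.asIdeal.ramificationIdx ℤ := by
  have h := not_ramificationIdx_le_of_pow_prime v hp hp2 hv x hx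
  omega

/-! ## 3. Packet and column level at `v_ℚ = p` -/

/-- A place of the fibre over the prime `p` is a finite place `w` with `p ∈ 𝔭_w`. [folklore] -/
theorem natCast_mem_of_over_eq (X : PilotData F) (p : Nat.Primes) {x : Place F}
    (hx : (thetaIndex X).over x = (.inr p : RatPlace)) :
    ∃ w : HeightOneSpectrum (𝓞 F), x = .inr w ∧ ((p : ℕ) : 𝓞 F) ∈ w.asIdeal := by
  rcases x with w | w
  · exact absurd hx (by simp [thetaIndex])
  · refine ⟨w, rfl, ?_⟩
    have hres : residueChar F w = p := by
      have h := hx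
      simp only [thetaIndex, Place.under_inr, Sum.inr.injEq] at h
      exact congrArg Subtype.val h
    rw [← hres]
    exact natCast_residueChar_mem F w

/-- A `p`-th root of `p` in `F` gives one in every completion. [folklore] -/
theorem exists_pow_prime_eq_adicCompletion {p : ℕ} {α : F} (hα : α ^ p = (p : F)) (v : HeightOneSpectrum (𝓞 F)) :
    ∃ x : v.adicCompletion F, x ^ p = (p : v.adicCompletion F) :=
  ⟨algebraMap F (v.adicCompletion F) α, by rw [← map_pow, hα, map_natCast]⟩

/-- **If `F` contains a `p`-th root of the odd prime `p`, every honest component of depth `2` over `v_ℚ = p` is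
NONEMPTY.** [claim: Mochizuki2012, status: disputed] -/
theorem honestU_two_nonempty_of_pow_prime_mem (X : PilotData F) (p : Nat.Primes) (hp2 : (p : ℕ) ≠ 2) {α : F}
    (hα : α ^ (p : ℕ) = ((p : ℕ) : F)) (m : ℤ) (v : (thetaIndex X).Fibre (.inr p : RatPlace)) :
    (honestU X (analyticLogv F) m 2 (.inr p) v).Nonempty := by
  obtain ⟨x, hx⟩ := v
  obtain ⟨w, rfl, hw⟩ := natCast_mem_of_over_eq X p hx
  obtain ⟨y, hy⟩ := exists_pow_prime_eq_adicCompletion hα w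
  exact nonarchIterImage_analyticLogv_two_nonempty_of_pow_prime w p.2 hp2 hw y hy

/-- **NON-VACUITY OF A DEPTH-`2` (Ind3) CLAUSE at `v_ℚ = p`, `p` odd**: for pilot data `X` over a number field
containing a `p`-th root of `p` and ANY column over `Real.logShellsDH X (analyticLogv F)` with honest unit images
(abc-iut-w4-d029's `hunit`), the unit image at `(m, m′ = 2, j, v_ℚ = p)` is NONEMPTY.
[claim: Mochizuki2012, status: disputed] -/
theorem _root_.Summit.ABC.IUTFork.Thm311.Column.unitImage_two_nonempty_of_honestImages_of_pow_prime_mem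
    (X : PilotData F) (p : Nat.Primes) (hp2 : (p : ℕ) ≠ 2) {α : F} (hα : α ^ (p : ℕ) = ((p : ℕ) : F))
    (C : Column (logShellsDH X (analyticLogv F)))
    (hunit : ∀ (m : ℤ) (m' : ℕ) (j : (thetaIndex X).Label) (vQ : (thetaIndex X).VQ),
      C.unitImage m m' j vQ =
        (logShellsDH X (analyticLogv F)).tprodImages j vQ (honestU X (analyticLogv F) m m' vQ))
    (m : ℤ) (j : (thetaIndex X).Label) :
    (C.unitImage m 2 j (.inr p : RatPlace)).Nonempty := by
  rw [hunit]
  exact LogShells.tprodImages_nonempty_of_forall_nonempty _ j _ _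
    (honestU_two_nonempty_of_pow_prime_mem X p hp2 hα m)

/-! ## 4. The instance exists for every odd prime -/

/-- **A number field with a `p`-th root of `p`**: `ℚ[X]/(g)` for an irreducible factor `g` of `Xᵖ − p` (`p ≥ 1`).
[folklore] -/
theorem exists_numberField_pow_prime_eq {p : ℕ} (hp : p.Prime) :
    ∃ (F : Type) (_ : Field F) (_ : NumberField F) (α : F), α ^ p = (p : F) := by
  let f : ℚ[X] := X ^ p - C (p : ℚ)
  have hf : f.natDegree = p := natDegree_X_pow_sub_C
  have hfne : f.natDegree ≠ 0 := by rw [hf]; exact hp.ne_zero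
  haveI : Fact (Irreducible f.factor) := ⟨irreducible_factor f⟩
  have hg0 : f.factor ≠ 0 := (irreducible_factor f).ne_zero
  haveI : Module.Finite ℚ (AdjoinRoot f.factor) := (AdjoinRoot.powerBasis hg0).finite
  haveI : CharZero (AdjoinRoot f.factor) :=
    charZero_of_injective_algebraMap (algebraMap ℚ (AdjoinRoot f.factor)).injective
  haveI : NumberField (AdjoinRoot f.factor) := NumberField.mk
  refine ⟨AdjoinRoot f.factor, inferInstance, inferInstance, AdjoinRoot.root f.factor, ?_⟩
  have hdvd : f.factor ∣ f := factor_dvd_of_natDegree_ne_zero hfne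
  have halg : algebraMap ℚ (AdjoinRoot f.factor) = AdjoinRoot.of f.factor := Subsingleton.elim _ _
  have hroot : aeval (AdjoinRoot.root f.factor) f.factor = 0 := by
    rw [aeval_def, halg]
    exact AdjoinRoot.eval₂_root f.factor
  have h0 : aeval (AdjoinRoot.root f.factor) f = 0 := aeval_eq_zero_of_dvd_aeval_eq_zero hdvd hroot
  have h1 : aeval (AdjoinRoot.root f.factor) f = AdjoinRoot.root f.factor ^ p - p := by
    simp [f, map_natCast]
  rw [h1, sub_eq_zero] at h0
  exact h0

/-- **EXISTENCE AT EVERY ODD PRIME**: for every odd prime `p` there are a number field `F` and a finite place `v`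
with `p_v = p` at which the honest depth-`2` (Ind3) iterate image for the analytic logarithms is NONEMPTY and the
hypothesis `e(v|p_v) ≤ p_v − 1` of p414009 fails — the tame threshold is sharp at every odd prime.
[claim: Mochizuki2012, status: disputed] -/
theorem exists_numberField_nonarchIterImage_two_nonempty_of_odd_prime {p : ℕ} (hp : p.Prime) (hp2 : p ≠ 2) :
    ∃ (F : Type) (_ : Field F) (_ : NumberField F) (v : HeightOneSpectrum (𝓞 F)),
      residueChar F v = p ∧ (nonarchIterImage (analyticLogv F) v 2).Nonempty ∧
        ¬ v.asIdeal.ramificationIdx ℤ ≤ residueChar F v - 1 := by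
  obtain ⟨F, _, _, α, hα⟩ := exists_numberField_pow_prime_eq hp
  obtain ⟨v, hv⟩ := exists_heightOneSpectrum_natCast_mem' (F := F) hp
  obtain ⟨x, hx⟩ := exists_pow_prime_eq_adicCompletion hα v
  exact ⟨F, inferInstance, inferInstance, v, residueChar_eq_of_prime_natCast_mem v hp hv,
    nonarchIterImage_analyticLogv_two_nonempty_of_pow_prime v hp hp2 hv x hx,
    not_ramificationIdx_le_of_pow_prime v hp hp2 hv x hx⟩

end Summit.ABC.IUTFork.Thm311.Real

end
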